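import Summits.HubbardSuperconductivity.HubbardSuperconductivity.Theorems.SoloBlindOrderNotEnergyRobust
import HarnessLib

/-!
# The low-order competitor is invisible to all diagonal (density-type) observables

Sharpening of `dWave_order_not_energy_robust` (`SoloBlindOrderNotEnergyRobust`): the competitor
state produced there is a twisted copy `W_mᴴ ψ` of the given ground state `ψ` (`W_m = twistOp m`,
a diagonal unitary in the occupation-number basis of Fock space). Consequently it has, besides the
same sector, unit norm, energy `≤ E₀ + ε(c,t)` and d-wave order `< c L⁴`, EXACTLY THE SAME
expectation value as `ψ` for every observable that is diagonal in the occupation basis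
(`twist_expect_diagonal`): all site densities `n_{xσ}`, double occupancies, density–density and
`S^z S^z` correlation functions at all distances, the Hubbard interaction energy, and any function
of them.

* `twist_expect_diagonal` — `⟨W_mᴴψ, D W_mᴴψ⟩ = ⟨ψ, D ψ⟩` for every diagonal `D` and all `m, ψ`.
* `exists_twistIndex_low_energy_small_order` — the pigeonhole step of
  `exists_twist_low_energy_small_order` with the winding `j ∈ {1, …, M}` exposed.
* `dWave_order_not_diagonal_robust` — for all `t, U`, `c > 0` there are `ε, L₀` such that on every
  torus `L = n+1 ≥ L₀`, for every normalised ground state `ψ` of every joint sector there is a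
  normalised `φ` in the same sector with energy `≤ E₀ + ε`, d-wave order `< c L⁴`, and
  `⟨φ, D φ⟩ = ⟨ψ, D ψ⟩` for EVERY diagonal `D`. So no hypothesis on a ground state that is expressed
  through diagonal correlation functions (at any range) together with an `O(1)` energy tolerance can
  imply the d-wave order the summit asks for.

References: E. Lieb, T. Schultz, D. Mattis, Ann. Phys. 16 (1961) 407 (the twist is a diagonal
unitary); this tree's `SoloBlindGaugeTwist`, `SoloBlindOrderNotEnergyRobust`.
-/

namespace Summit.HubbardSuperconductivity.HubbardSuperconductivity.Theorems.GaugeTwist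

open Matrix Finset Literature.MathematicalPhysics.QuantumLattice
  Literature.MathematicalPhysics.QuantumFieldTheory
open scoped ComplexConjugate ComplexOrder

-- see `SoloBlindCertificateFromGap`: make instance synthesis agree with the landed terms
-- (`DecidableEq (FermionTorus 2 L)` through the linear order), file-locally.
attribute [-instance] instDecidableEqLex

variable {L : ℕ} [NeZero L]

/-- **Diagonal observables do not see the twist**: `⟨W_mᴴψ, D W_mᴴψ⟩ = ⟨ψ, D ψ⟩` for every
diagonal matrix `D = diagonal d` in the occupation-number basis. [folklore] -/
theorem twist_expect_diagonal (m : ZMod L) (d : Finset (Orb (FermionTorus 2 L)) → ℂ)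
    (ψ : Fock (Orb (FermionTorus 2 L))) :
    star ((twistOp m)ᴴ *ᵥ ψ) ⬝ᵥ (diagonal d *ᵥ ((twistOp m)ᴴ *ᵥ ψ)) =
      star ψ ⬝ᵥ (diagonal d *ᵥ ψ) := by
  unfold twistOp
  rw [phaseGauge_eq, diagonal_conjTranspose]
  simp only [dotProduct, mulVec_diagonal, Pi.star_apply, star_mul', star_star]
  refine Finset.sum_congr rfl fun S _ => ?_
  set c : ℂ := ((∏ o ∈ S, (fun u : FermionTorus 2 L => twistChar m u.toTorusSite) (ofLex o).1 :
    Circle) : ℂ) with hc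
  have h1 : c * star c = 1 := by
    rw [hc, Complex.star_def, Complex.mul_conj, Circle.normSq_coe, Complex.ofReal_one]
  linear_combination (star (ψ S) * d S * ψ S) * h1

/-- The pigeonhole step of `exists_twist_low_energy_small_order` with the winding exposed: for a
normalised sector ground state `ψ`, `|g| ≤ 1`, `1 ≤ M < L`, some `j ∈ {1,…,M}` has
`re ⟨W_jᴴψ, H W_jᴴψ⟩ ≤ E₀ + 8π²|t|(M²+M)` and `re ⟨Δ_g W_jᴴψ, Δ_g W_jᴴψ⟩ ≤ 400 L⁴ / M`. [folklore] -/
theorem exists_twistIndex_low_energy_small_order (hL : 3 ≤ L) (t U : ℝ) {N : ℕ} {Mz : ℝ}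
    {ψ : Fock (Orb (FermionTorus 2 L))} (hψ : IsGroundStateInSector (hubbardTorus 2 L t U) N Mz ψ)
    (h1 : star ψ ⬝ᵥ ψ = 1) (g : (Fin 2 → ℤ) → ℝ) (hg : ∀ e, |g e| ≤ 1) {M : ℕ} (hM : 1 ≤ M)
    (hML : M < L) :
    ∃ j : ℕ, 1 ≤ j ∧ j ≤ M ∧
      (star ((twistOp (j : ZMod L))ᴴ *ᵥ ψ) ⬝ᵥ
          (hubbardTorus 2 L t U *ᵥ ((twistOp (j : ZMod L))ᴴ *ᵥ ψ))).re ≤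
        (hubbardTorus 2 L t U).minEnergyOn (szSector N Mz) + 8 * Real.pi ^ 2 * |t| * ((M : ℝ) ^ 2 + M) ∧
      (star (pairField g L *ᵥ ((twistOp (j : ZMod L))ᴴ *ᵥ ψ)) ⬝ᵥ
          (pairField g L *ᵥ ((twistOp (j : ZMod L))ᴴ *ᵥ ψ))).re ≤ 400 * (L : ℝ) ^ 4 / M := by
  classical
  set T : ZMod L → ℝ := fun m => (star (pairField g L *ᵥ ((twistOp m)ᴴ *ᵥ ψ)) ⬝ᵥ
    (pairField g L *ᵥ ((twistOp m)ᴴ *ᵥ ψ))).re with hT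
  have hT0 : ∀ m, 0 ≤ T m := fun m => by
    simp only [hT]
    rw [← norm_toLp_sq_eq_re]
    positivity
  have htot : ∑ m : ZMod L, T m ≤ 400 * (L : ℝ) ^ 4 := by
    have := sum_twist_pairField_order_le g hg ψ
    rwa [h1, Complex.one_re, mul_one] at this
  set S : Finset ℕ := Finset.Icc 1 M with hS
  have hinj : ∀ i ∈ S, ∀ j ∈ S, ((i : ℕ) : ZMod L) = ((j : ℕ) : ZMod L) → i = j := by
    intro i hi j hj hij
    rw [hS, Finset.mem_Icc] at hi hj
    have := (ZMod.natCast_eq_natCast_iff' i j L).1 hij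
    rwa [Nat.mod_eq_of_lt (by omega), Nat.mod_eq_of_lt (by omega)] at this
  have hpart : ∑ j ∈ S, T (j : ZMod L) ≤ 400 * (L : ℝ) ^ 4 := by
    rw [← Finset.sum_image hinj]
    exact (Finset.sum_le_sum_of_subset_of_nonneg (Finset.subset_univ _) fun m _ _ => hT0 m).trans
      htot
  have hSne : S.Nonempty := ⟨1, by rw [hS, Finset.mem_Icc]; omega⟩
  have hM0 : (M : ℝ) ≠ 0 := by exact_mod_cast (show M ≠ 0 by omega)
  obtain ⟨j, hjS, hj⟩ : ∃ j ∈ S, T (j : ZMod L) ≤ 400 * (L : ℝ) ^ 4 / M := by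
    apply Finset.exists_le_of_sum_le hSne
    rw [Finset.sum_const, hS, Nat.card_Icc, Nat.add_sub_cancel, nsmul_eq_mul, ← mul_div_assoc,
      mul_div_cancel_left₀ _ hM0]
    exact hpart
  rw [hS, Finset.mem_Icc] at hjS
  refine ⟨j, hjS.1, hjS.2, ?_, hj⟩
  refine (re_twist_energy_le_minEnergyOn_add hL t U hψ h1 j (Or.inl rfl)).trans ?_
  have hjM : (j : ℝ) ≤ M := by exact_mod_cast hjS.2
  have hj0 : (0 : ℝ) ≤ j := Nat.cast_nonneg j
  have hsq : (j : ℝ) ^ 2 + j ≤ (M : ℝ) ^ 2 + M := by nlinarith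
  have := mul_le_mul_of_nonneg_left hsq (by positivity : (0 : ℝ) ≤ 8 * Real.pi ^ 2 * |t|)
  linarith

/-- **The d-wave order criterion is not robust under "energy + all diagonal correlations"**: for
all `t, U` and `c > 0` there are `ε` (explicitly `8π²|t|(M²+M)`, `M = ⌊400/c⌋+1`) and `L₀` such
that for every side `L = n+1 ≥ L₀` and every normalised ground state `ψ` of every joint sector
`(N, S^z)` there is a normalised `φ` of the same sector with energy `≤ E₀ + ε`, d-wave pair-field
order `< c L⁴`, and the same expectation as `ψ` for every diagonal observable. [this work] -/
theorem dWave_order_not_diagonal_robust (t U c : ℝ) (hc : 0 < c) :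
    ∃ ε : ℝ, ∃ L₀ : ℕ, ∀ n : ℕ, L₀ ≤ n + 1 →
      ∀ {N : ℕ} {Mz : ℝ} {ψ : Fock (Orb (FermionTorus 2 (n + 1)))},
        IsGroundStateInSector (hubbardTorus 2 (n + 1) t U) N Mz ψ → star ψ ⬝ᵥ ψ = 1 →
        ∃ φ ∈ szSector N Mz, star φ ⬝ᵥ φ = 1 ∧
          (star φ ⬝ᵥ (hubbardTorus 2 (n + 1) t U *ᵥ φ)).re ≤
              (hubbardTorus 2 (n + 1) t U).minEnergyOn (szSector N Mz) + ε ∧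
          (star (pairField dWaveFormFactor (n + 1) *ᵥ φ) ⬝ᵥ
              (pairField dWaveFormFactor (n + 1) *ᵥ φ)).re < c * ((n : ℝ) + 1) ^ 4 ∧
          ∀ d : Finset (Orb (FermionTorus 2 (n + 1))) → ℂ,
            star φ ⬝ᵥ (diagonal d *ᵥ φ) = star ψ ⬝ᵥ (diagonal d *ᵥ ψ) := by
  set M : ℕ := ⌊400 / c⌋₊ + 1 with hM
  refine ⟨8 * Real.pi ^ 2 * |t| * ((M : ℝ) ^ 2 + M), M + 3, fun n hn N Mz ψ hψ h1 => ?_⟩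
  have hM1 : 1 ≤ M := by omega
  have hML : M < n + 1 := by omega
  obtain ⟨j, -, -, hE, hO⟩ := exists_twistIndex_low_energy_small_order (L := n + 1) (by omega) t U
    hψ h1 dWaveFormFactor abs_dWaveFormFactor_le_one hM1 hML
  push_cast at hO
  refine ⟨(twistOp (j : ZMod (n + 1)))ᴴ *ᵥ ψ, twist_mem_szSector _ hψ.1,
    by rw [star_twist_dotProduct_twist, h1], hE, hO.trans_lt ?_,
    fun d => twist_expect_diagonal _ d ψ⟩
  have hcM : 400 / c < M := by rw [hM]; push_cast; exact Nat.lt_floor_add_one _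
  have hn4 : (0 : ℝ) < ((n : ℝ) + 1) ^ 4 := by positivity
  have hM0 : (0 : ℝ) < M := by exact_mod_cast hM1
  rw [div_lt_iff₀ hM0]
  calc 400 * ((n : ℝ) + 1) ^ 4 = 400 / c * (c * ((n : ℝ) + 1) ^ 4) := by field_simp
    _ < M * (c * ((n : ℝ) + 1) ^ 4) := by gcongr
    _ = c * ((n : ℝ) + 1) ^ 4 * M := by ring

end Summit.HubbardSuperconductivity.HubbardSuperconductivity.Theorems.GaugeTwist
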